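import Summits.Ventures.YMGap.Thresholds.CouplingSignFlip
import Summits.Ventures.YMGap.StrongCouplingGapShape
import HarnessLib

/-!
# Venture YMGap — the coupling-sign symmetry `β ↔ -β` of `SU(2)` lattice Yang–Mills on `ℤ^d`, part 2:
# the Shen–Zhu–Zhu-shaped mass-gap statement is symmetric, and one-sided rows give the two-sided window

HONEST FRAMING: venture file (cell `pub-ymgap`, track (c) «DS», red-team brick of ds-3), strong-coupling
LATTICE bookkeeping about the tree's predicates `MassGapAt d N β` / `MassGapBelow` / `ImprovedThreshold`
(`StrongCouplingGapShape.lean`) for `N = 2`; nothing about the continuum, confinement or the Clay mass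
gap, and NO coupling window is asserted here — the inputs are one-sided rows supplied elsewhere (the
track-(c) JOIN).  Theorems only.

* `isLipschitzCylinder_comp_flip` — Lipschitz cylinder functions pull back along the staggered centre
  flip (`CouplingSignFlip.flip`) with the same support and constant (entrywise `±1` is a sup-isometry);
* `clustering_neg`, `massGapAt_two_neg : MassGapAt d 2 β → MassGapAt d 2 (-β)` (`massGapAt_two_neg_iff`)
  — DLR uniqueness transports by `hasUniqueGibbsMeasure_neg`, the covariance clause by pulling the
  observables back (`covariance_map_equiv`, `integral_map_equiv`);
* `massGapBelow_two_of_nonneg`, `improvedThreshold_two_of_nonneg` — rows on `0 ≤ β ≤ β₀` give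
  `MassGapBelow d 2 β₀`, and with `1/(16(d-1)) < β₀` the track-(a) target type `ImprovedThreshold d 2 β₀`.

References: as in `CouplingSignFlip.lean`; H. Shen, R. Zhu, X. Zhu, CMP 400 (2023) Thm 1.2 / Cor 1.4
(the two-sided window `|β| < 1/(16(d-1))`).
-/

noncomputable section

open MeasureTheory ProbabilityTheory Finset Function
open scoped NNReal
open Literature.Probability.LatticeModels
open Literature.MathematicalPhysics.QuantumLattice
open Literature.MathematicalPhysics.QuantumFieldTheory (IsLipschitzCylinder setDistEdges)
open Literature.MathematicalPhysics.QuantumFieldTheory.Tomboulis2007 (SU2)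

namespace Summit.Ventures.YMGap.SignFlip

variable {d : ℕ}

/-! ### Lipschitz cylinder functions pull back along the flip -/

/-- **A Lipschitz cylinder function composed with the flip is a Lipschitz cylinder function with the
same support and constant**: the flip multiplies the matrix entries on each link by `±1`, an isometry
of the sup metric. [folklore] -/
theorem isLipschitzCylinder_comp_flip {F : LGConfig d SU2 → ℝ} {Λ : Finset (ZdEdge d)} {K : ℝ≥0}
    (hF : IsLipschitzCylinder (fundamentalRep (Fin 2)) F Λ K) :
    IsLipschitzCylinder (fundamentalRep (Fin 2)) (F ∘ flip) Λ K := by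
  obtain ⟨f, hf, hFf⟩ := hF
  let c : ↥Λ → ℂ := fun e => if Even (ksPhase (e : ZdEdge d)) then 1 else -1
  let g : (↥Λ → Fin 2 → Fin 2 → ℂ) → (↥Λ → Fin 2 → Fin 2 → ℂ) := fun M e i j => c e * M e i j
  have hc : ∀ e, ‖c e‖ = 1 := fun e => by
    simp only [c]
    split_ifs <;> simp
  have hg : LipschitzWith 1 g := by
    refine LipschitzWith.mk_one fun M M' => ?_
    refine (dist_pi_le_iff dist_nonneg).2 fun e => (dist_pi_le_iff dist_nonneg).2 fun i =>
      (dist_pi_le_iff dist_nonneg).2 fun j => ?_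
    show dist (c e * M e i j) (c e * M' e i j) ≤ dist M M'
    rw [dist_eq_norm, ← mul_sub, norm_mul, hc, one_mul, ← dist_eq_norm]
    exact ((dist_le_pi_dist (M e i) (M' e i) j).trans (dist_le_pi_dist (M e) (M' e) i)).trans
      (dist_le_pi_dist M M' e)
  refine ⟨f ∘ g, by simpa using hf.comp hg, fun U => ?_⟩
  rw [Function.comp_apply, hFf, Function.comp_apply]
  congr 1
  funext e i j
  simp only [g, c, flip_apply, linkSign, fundamentalRep_apply, coe_sgn_mul]
  split_ifs <;> simp

/-! ### The mass-gap statement is symmetric in the sign of the coupling -/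

/-- **The Shen–Zhu–Zhu clustering clause transports along the flip.**  If every DLR state at
coupling `b` satisfies the covariance clause of `MassGapAt`, so does every DLR state at `-b`: a
state `μ'` at `-b` is the flip of the state `μ' ∘ flip⁻¹` at `b`, Lipschitz cylinders pull back with
the same data, and covariances / `L²` norms are invariant (`covariance_map_equiv`,
`integral_map_equiv`). [folklore] -/
theorem clustering_neg {b : ℝ}
    (h : ∀ μ ∈ ymGibbsMeasures (d := d) (fundamentalRep (Fin 2)) b,
      ∃ c : ℝ, 0 < c ∧ ∀ n : ℕ, ∃ c₁ : ℝ,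
        ∀ (F₁ F₂ : LGConfig d (Matrix.specialUnitaryGroup (Fin 2) ℂ) → ℝ)
          (Λ₁ Λ₂ : Finset (ZdEdge d)) (K₁ K₂ : ℝ≥0),
          Λ₁.card ≤ n → Λ₂.card ≤ n → Disjoint Λ₁ Λ₂ →
          IsLipschitzCylinder (fundamentalRep (Fin 2)) F₁ Λ₁ K₁ →
          IsLipschitzCylinder (fundamentalRep (Fin 2)) F₂ Λ₂ K₂ →
            |cov[F₁, F₂; μ]| ≤ c₁ * Real.exp (-c * setDistEdges Λ₁ Λ₂) *
              ((K₁ : ℝ) * K₂ + Real.sqrt (∫ U, F₁ U ^ 2 ∂μ) * Real.sqrt (∫ U, F₂ U ^ 2 ∂μ))) :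
    ∀ μ ∈ ymGibbsMeasures (d := d) (fundamentalRep (Fin 2)) (-b),
      ∃ c : ℝ, 0 < c ∧ ∀ n : ℕ, ∃ c₁ : ℝ,
        ∀ (F₁ F₂ : LGConfig d (Matrix.specialUnitaryGroup (Fin 2) ℂ) → ℝ)
          (Λ₁ Λ₂ : Finset (ZdEdge d)) (K₁ K₂ : ℝ≥0),
          Λ₁.card ≤ n → Λ₂.card ≤ n → Disjoint Λ₁ Λ₂ →
          IsLipschitzCylinder (fundamentalRep (Fin 2)) F₁ Λ₁ K₁ →
          IsLipschitzCylinder (fundamentalRep (Fin 2)) F₂ Λ₂ K₂ →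
            |cov[F₁, F₂; μ]| ≤ c₁ * Real.exp (-c * setDistEdges Λ₁ Λ₂) *
              ((K₁ : ℝ) * K₂ + Real.sqrt (∫ U, F₁ U ^ 2 ∂μ) * Real.sqrt (∫ U, F₂ U ^ 2 ∂μ)) := by
  intro μ' hμ'
  -- `μ' ∘ flip⁻¹` is a DLR state at `b`
  have hμ : μ'.map flip ∈ ymGibbsMeasures (d := d) (fundamentalRep (Fin 2)) b := by
    simpa using isGibbsMeasure_map_flip (d := d) hμ'
  obtain ⟨c, hc, hcl⟩ := h _ hμ
  refine ⟨c, hc, fun n => ?_⟩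
  obtain ⟨c₁, hc₁⟩ := hcl n
  refine ⟨c₁, fun F₁ F₂ Λ₁ Λ₂ K₁ K₂ h₁ h₂ hd hF₁ hF₂ => ?_⟩
  have key := hc₁ (F₁ ∘ flip) (F₂ ∘ flip) Λ₁ Λ₂ K₁ K₂ h₁ h₂ hd
    (isLipschitzCylinder_comp_flip hF₁) (isLipschitzCylinder_comp_flip hF₂)
  -- covariances and second moments of `Fᵢ ∘ flip` under `μ' ∘ flip⁻¹` are those of `Fᵢ` under `μ'`
  have hcov : cov[F₁ ∘ flip, F₂ ∘ flip; μ'.map flip] = cov[F₁, F₂; μ'] := by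
    rw [← coe_flipEquiv, covariance_map_equiv]
    simp only [coe_flipEquiv, Function.comp_assoc, flip_involutive.comp_self, Function.comp_id]
  have hsq : ∀ F : LGConfig d SU2 → ℝ, ∫ U, (F ∘ flip) U ^ 2 ∂(μ'.map flip) = ∫ U, F U ^ 2 ∂μ' := by
    intro F
    rw [← coe_flipEquiv, integral_map_equiv]
    simp only [coe_flipEquiv, Function.comp_apply, flip_flip]
  rw [hcov, hsq, hsq] at key
  exact key

/-- **`MassGapAt d 2 β → MassGapAt d 2 (-β)`**: the strong-coupling mass-gap statement of
`StrongCouplingGapShape.lean` for `SU(2)` (DLR uniqueness + Shen–Zhu–Zhu clustering at 't Hooft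
coupling `β`, bare coupling `2β`) is symmetric in the sign of the coupling. [folklore] -/
theorem massGapAt_two_neg {β : ℝ} (h : MassGapAt d 2 β) : MassGapAt d 2 (-β) := by
  obtain ⟨huniq, hclus⟩ := h
  have hb : ((2 : ℕ) : ℝ) * -β = -(((2 : ℕ) : ℝ) * β) := by ring
  refine ⟨?_, ?_⟩
  · rw [hb]
    exact hasUniqueGibbsMeasure_neg huniq
  · rw [hb]
    exact clustering_neg hclus

/-- Iff form. [folklore] -/
theorem massGapAt_two_neg_iff (β : ℝ) : MassGapAt d 2 (-β) ↔ MassGapAt d 2 β :=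
  ⟨fun h => by simpa using massGapAt_two_neg (d := d) h, massGapAt_two_neg⟩

/-- **One-sided rows give the two-sided window**: if `MassGapAt d 2 β` holds at every
`0 ≤ β ≤ β₀`, then `MassGapBelow d 2 β₀` (`∀ β, |β| < β₀ → MassGapAt d 2 β`). [folklore] -/
theorem massGapBelow_two_of_nonneg {β₀ : ℝ} (h : ∀ β : ℝ, 0 ≤ β → β ≤ β₀ → MassGapAt d 2 β) :
    MassGapBelow d 2 β₀ := by
  intro β hβ
  rcases le_or_gt 0 β with h0 | h0
  · exact h β h0 (le_of_lt (abs_lt.1 hβ).2)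
  · have h1 : MassGapAt d 2 (-β) := h (-β) (by linarith) (by linarith [(abs_lt.1 hβ).1])
    simpa using massGapAt_two_neg (d := d) h1

/-- **… and the improved-threshold type**: one-sided rows on `[0, β₀]` with `β₀ > 1/(16(d-1))`
instantiate `ImprovedThreshold d 2 β₀`. [folklore] -/
theorem improvedThreshold_two_of_nonneg {β₀ : ℝ} (hβ₀ : 1 / (16 * ((d : ℝ) - 1)) < β₀)
    (h : ∀ β : ℝ, 0 ≤ β → β ≤ β₀ → MassGapAt d 2 β) : ImprovedThreshold d 2 β₀ :=
  ⟨hβ₀, massGapBelow_two_of_nonneg h⟩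

end Summit.Ventures.YMGap.SignFlip

end
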